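import Summits.Ventures.DiscreteObjects.Hadamard.FixedRowsOrbitTools

/-!
# Hadamard matrices of order 2p + 2 (p ≥ 5 prime): an automorphism of order p fixes exactly 2 + 2 lines (kernel)

Framing: lottery ticket; floor = certified bounds/negative ranges.

Cell pub-namedobj (venture DiscreteObjects), target (H), hadamard gen 9.  Third member of the uniform family obtained from
`FixedRowsOrbitTools` (with `HadamardOrder3p3`: order `3p+3` ⇒ no automorphism of order `p`; `HadamardOrder4q`: order `4p` ⇒
fixed-point-free, `4 + 4` orbits): **`hadamard2p2_fixedRows` — a nontrivial signed-permutation automorphism `(π, κ, d, e)`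
of order `p` (`p ≥ 5` prime) of a Hadamard matrix of order `2p + 2` fixes exactly two rows and two columns and has `2 + 2`
orbits of length `p`; the two fixed rows are orthogonal on the two fixed columns (the fixed `2 × 2` submatrix is a Hadamard
matrix of order 2).**  Orders covered (`p ≡ 1 (mod 4)`): `12 (p = 5)`, `28 (13)`, `36 (17)`, `60 (29)`, `76 (37)`, `84 (41)`, …
— the shape of the Paley/Tonchev matrices with an automorphism of order `(n − 2)/2`.  Proof: `f + p·w = 2p + 2` gives
`(w, f) ∈ {(0, 2p+2), (1, p+2), (2, 2)}`; `w = 1`: three fixed rows would give `0 ≤ 3(p+2) − 6p < 0` (PSD sum with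
`S = −p ψ_u ψ_u'`), so `f_r ≤ 2`, `f_r = 2`, `w_r = 2`, and the transpose is in case (`w = 2`, `f = 2`) with `p + 2 ≥ 3` fixed
rows; `w = 2`, `f = 2`: for two fixed rows the fixed part `S` (`|S| ≤ 2 < p`) is divisible by `p`, so `S = 0` and the class part
vanishes: three fixed rows give three pairwise orthogonal sign vectors in `ℚ²` — absurd; `w = 0`: identity.  Ours/folklore;
no `sorry`.

Print status (lead F-H8, 2026-08-21): the `2 + 2` shape is the KNOWN Paley/Tonchev shape — an automorphism of order p of a
Hadamard matrix of order 2p + 2 comes from an automorphism with one fixed point of the derived 2-(2p+1, p, (p−1)/2) design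
(Dembowski, Finite Geometries, p. 82; Tonchev 1986, Nagoya Math. J. 104; Dalan–Harada–Munemasa 2002, p. 94; Araya–Harada–
Tonchev 2024, §2 [cite: ArayaHaradaTonchev2024, §2]).  This file gives an independent machine-checked elementary proof of the
uniform statement; no novelty is claimed for the statement.
-/

open Finset BigOperators Matrix

namespace Summit.Ventures.DiscreteObjects.Hadamard

open Literature.Combinatorics.Designs.GoethalsSeidel (IsHadamardMatrix)

variable {ι : Type*} [Fintype ι] [DecidableEq ι]

section order2p2

variable {H : Matrix ι ι ℤ} {π κ : Equiv.Perm ι} {d e : ι → ℤ} {p : ℕ}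

/-- the product of two entries is `±1` -/
private lemma entryProd_pm2 (hH : IsHadamardMatrix H) (i i' j j' : ι) :
    H i j * H i' j' = 1 ∨ H i j * H i' j' = -1 := by
  rcases hH.1 i j with h | h <;> rcases hH.1 i' j' with h' | h' <;> simp [h, h']

/-- `w = 2`, `f = 2`: three fixed rows are impossible -/
private lemma case_w2f2 (hH : IsHadamardMatrix H) (haut : IsSignedAut H π κ d e) (hp : p.Prime) (hp5 : 5 ≤ p)
    (hκ : κ ^ p = 1) (uu : Fin 3 → ι) (huu : Function.Injective uu) (hfix : ∀ i, π (uu i) = uu i)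
    (rep : Finset ι → ι) (hrep : ∀ C ∈ blockClasses κ p, rep C ∈ C)
    (hk : (blockClasses κ p).card = 2) (hf : (univ.filter fun j => κ j = j).card = 2) : False := by
  have hodd : Odd p := hp.odd_of_ne_two (by omega)
  set Fc := (univ.filter fun j => κ j = j) with hFc
  have hpos : (0 : ℤ) < p := by exact_mod_cast hp.pos
  have hT : ∀ i i', i ≠ i' → ∑ C ∈ blockClasses κ p, H (uu i) (rep C) * H (uu i') (rep C) = 0 := by
    intro i i' hii'
    have hs := fixedRows_split hH haut hp hodd hκ (hfix i) (hfix i') (huu.ne hii') rep hrep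
    have hpm : ∀ j ∈ Fc, H (uu i) j * H (uu i') j = 1 ∨ H (uu i) j * H (uu i') j = -1 :=
      fun j _ => entryProd_pm2 hH _ _ _ _
    have habs := abs_sum_pm_le_card Fc (fun j => H (uu i) j * H (uu i') j) hpm
    rw [hf] at habs
    have hb := abs_le.mp habs
    set S := ∑ j ∈ Fc, H (uu i) j * H (uu i') j with hS
    set T := ∑ C ∈ blockClasses κ p, H (uu i) (rep C) * H (uu i') (rep C) with hTdef
    push_cast at hb hs
    -- S = -p T with |S| ≤ 2 < p ⇒ T = 0
    by_contra hT0
    rcases lt_or_gt_of_ne hT0 with hlt | hgt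
    · have : (p : ℤ) * T ≤ (p : ℤ) * (-1) := mul_le_mul_of_nonneg_left (by omega) hpos.le
      have h5 : (5 : ℤ) ≤ p := by exact_mod_cast hp5
      nlinarith
    · have : (p : ℤ) * 1 ≤ (p : ℤ) * T := mul_le_mul_of_nonneg_left (by omega) hpos.le
      have h5 : (5 : ℤ) ≤ p := by exact_mod_cast hp5
      nlinarith
  let v : Fin 3 → {C // C ∈ blockClasses κ p} → ℚ := fun i C => (H (uu i) (rep C.1) : ℚ)
  have horth : ∀ i i', i ≠ i' → ∑ C, v i C * v i' C = 0 := by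
    intro i i' hii'
    have h1 : ∑ C : {C // C ∈ blockClasses κ p}, v i C * v i' C =
        ∑ C ∈ blockClasses κ p, ((H (uu i) (rep C) * H (uu i') (rep C) : ℤ) : ℚ) := by
      rw [← Finset.sum_coe_sort (blockClasses κ p)]
      simp [v]
    rw [h1, ← Int.cast_sum, hT i i' hii', Int.cast_zero]
  obtain ⟨C₀, hC₀⟩ : (blockClasses κ p).Nonempty := Finset.card_pos.mp (by rw [hk]; norm_num)
  have hnz : ∀ i, ∃ C, v i C ≠ 0 := by
    intro i
    refine ⟨⟨C₀, hC₀⟩, ?_⟩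
    rcases hH.1 (uu i) (rep C₀) with h | h <;> simp [v, h]
  have hle := card_le_of_pairwise_orthogonal v hnz horth
  rw [Fintype.card_coe, hk] at hle
  omega

/-- `w = 1`, `f = p + 2`: three fixed rows are impossible -/
private lemma case_w1f (hH : IsHadamardMatrix H) (haut : IsSignedAut H π κ d e) (hp : p.Prime) (hp5 : 5 ≤ p)
    (hκ : κ ^ p = 1) (uu : Fin 3 → ι) (huu : Function.Injective uu) (hfix : ∀ i, π (uu i) = uu i)
    (rep : Finset ι → ι) (hrep : ∀ C ∈ blockClasses κ p, rep C ∈ C)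
    (hk : (blockClasses κ p).card = 1) (hf : (univ.filter fun j => κ j = j).card = p + 2) : False := by
  have hodd : Odd p := hp.odd_of_ne_two (by omega)
  set Fc := (univ.filter fun j => κ j = j) with hFc
  obtain ⟨C₁, hcls⟩ := Finset.card_eq_one.mp hk
  let ψ : Fin 3 → ℤ := fun i => H (uu i) (rep C₁)
  have hψ : ∀ i, ψ i * ψ i = 1 := fun i => pm_mul_self (hH.1 _ _)
  let c : Fin 3 → Fin 3 → ℤ := fun i i' => ∑ j ∈ Fc, (ψ i * H (uu i) j) * (ψ i' * H (uu i') j)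
  have hc : ∀ i i', c i i' = -(p : ℤ) + (if i = i' then 2 * (p : ℤ) + 2 else 0) := by
    intro i i'
    have hci : c i i' = ψ i * ψ i' * ∑ j ∈ Fc, H (uu i) j * H (uu i') j := by
      simp only [c, Finset.mul_sum]
      apply Finset.sum_congr rfl
      intro j _
      ring
    by_cases hii' : i = i'
    · subst hii'
      rw [if_pos rfl, hci, hψ i, one_mul]
      calc ∑ j ∈ Fc, H (uu i) j * H (uu i) j = ∑ j ∈ Fc, (1 : ℤ) :=
            Finset.sum_congr rfl (fun j _ => pm_mul_self (hH.1 _ _))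
        _ = -(p : ℤ) + (2 * p + 2) := by rw [Finset.sum_const, nsmul_eq_mul, mul_one, hf]; push_cast; ring
    · rw [if_neg hii', hci, add_zero]
      have hs := fixedRows_split hH haut hp hodd hκ (hfix i) (hfix i') (huu.ne hii') rep hrep
      rw [hcls, Finset.sum_singleton] at hs
      have hS : ∑ j ∈ Fc, H (uu i) j * H (uu i') j = -(p : ℤ) * (ψ i * ψ i') := by
        simp only [ψ]; linarith
      rw [hS]
      calc ψ i * ψ i' * (-(p : ℤ) * (ψ i * ψ i')) = -(p : ℤ) * ((ψ i * ψ i) * (ψ i' * ψ i')) := by ring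
        _ = -(p : ℤ) := by rw [hψ i, hψ i', mul_one, mul_one]
  have hQ : (0 : ℤ) ≤ ∑ j ∈ Fc, (∑ i, ψ i * H (uu i) j) * (∑ i, ψ i * H (uu i) j) :=
    Finset.sum_nonneg (fun j _ => mul_self_nonneg _)
  have hQ' : ∑ j ∈ Fc, (∑ i, ψ i * H (uu i) j) * (∑ i, ψ i * H (uu i) j) = ∑ i, ∑ i', c i i' := by
    simp only [c]
    simp_rw [Finset.sum_mul_sum]
    rw [Finset.sum_comm]
    apply Finset.sum_congr rfl
    intro i _
    rw [Finset.sum_comm]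
  have hval : ∑ i : Fin 3, ∑ i' : Fin 3, (-(p : ℤ) + (if i = i' then 2 * (p : ℤ) + 2 else 0)) = 6 - 3 * (p : ℤ) := by
    simp only [Finset.sum_add_distrib, Finset.sum_const, Finset.card_univ, Fintype.card_fin, Finset.sum_ite_eq,
      Finset.mem_univ, if_true]
    ring
  rw [hQ'] at hQ
  simp only [hc] at hQ
  rw [hval] at hQ
  have : (5 : ℤ) ≤ p := by exact_mod_cast hp5
  linarith

/-- extracting `n` distinct fixed rows -/
private lemma fixed_rows_of_le2 (n : ℕ) (hn : n ≤ (univ.filter fun i => π i = i).card) :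
    ∃ uu : Fin n → ι, Function.Injective uu ∧ ∀ i, π (uu i) = uu i := by
  obtain ⟨t, ht, htc⟩ := Finset.exists_subset_card_eq hn
  let eqv := Finset.equivFinOfCardEq htc
  refine ⟨fun i => (eqv.symm i).1, fun a b h => eqv.symm.injective (Subtype.ext h),
    fun i => (Finset.mem_filter.mp (ht (eqv.symm i).2)).2⟩

/-- class representatives -/
private lemma exists_rep2 (hp : p.Prime) (hκ : κ ^ p = 1) (x₀ : ι) :
    ∃ rep : Finset ι → ι, ∀ C ∈ blockClasses κ p, rep C ∈ C := by
  classical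
  have hne : ∀ C ∈ blockClasses κ p, C.Nonempty := fun C hC =>
    Finset.card_pos.mp (by rw [card_of_mem_blockClasses κ hp hκ hC]; exact hp.pos)
  refine ⟨fun C => if h : C.Nonempty then h.choose else x₀, fun C hC => ?_⟩
  simp only [dif_pos (hne C hC)]
  exact (hne C hC).choose_spec

/-- at most two fixed rows once `κ` has a class (order `2p + 2`) -/
private lemma fixedRows_le_two (hH : IsHadamardMatrix H) (haut : IsSignedAut H π κ d e) (hp : p.Prime) (hp5 : 5 ≤ p)
    (hι : Fintype.card ι = 2 * p + 2) (hκ : κ ^ p = 1) (hw : 1 ≤ (blockClasses κ p).card) :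
    (univ.filter fun i => π i = i).card ≤ 2 := by
  have hcount := card_fixed_add_classes κ hp hκ
  rw [hι] at hcount
  have hw2 : (blockClasses κ p).card ≤ 2 := by
    by_contra h3
    have : 3 * p ≤ (blockClasses κ p).card * p := Nat.mul_le_mul_right p (by omega)
    omega
  obtain ⟨x₀⟩ : Nonempty ι := by
    rw [← Fintype.card_pos_iff, hι]; omega
  obtain ⟨rep, hrep⟩ := exists_rep2 (κ := κ) hp hκ x₀
  by_contra hlt
  obtain ⟨uu, huu, hfix⟩ := fixed_rows_of_le2 (π := π) 3 (by omega)
  rcases Nat.lt_or_ge (blockClasses κ p).card 2 with h1 | h2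
  · have hk : (blockClasses κ p).card = 1 := by omega
    rw [hk] at hcount
    exact case_w1f hH haut hp hp5 hκ uu huu hfix rep hrep hk (by omega)
  · have hk : (blockClasses κ p).card = 2 := by omega
    rw [hk] at hcount
    exact case_w2f2 hH haut hp hp5 hκ uu huu hfix rep hrep hk (by omega)

/-- **Order `p` in a Hadamard matrix of order `2p + 2`, `p ≥ 5` prime: exactly `2 + 2` fixed lines, `2 + 2` orbits, and the
fixed `2 × 2` submatrix is a Hadamard matrix of order 2.** -/
theorem hadamard2p2_fixedRows (hH : IsHadamardMatrix H) (p : ℕ) (hp : p.Prime) (hp5 : 5 ≤ p)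
    (hι : Fintype.card ι = 2 * p + 2) (π κ : Equiv.Perm ι) (d e : ι → ℤ) (haut : IsSignedAut H π κ d e)
    (hπ : π ^ p = 1) (hκ : κ ^ p = 1) (hne : π ≠ 1 ∨ κ ≠ 1) :
    (univ.filter fun i => π i = i).card = 2 ∧ (univ.filter fun j => κ j = j).card = 2 ∧
    (blockClasses π p).card = 2 ∧ (blockClasses κ p).card = 2 ∧
    (∀ u u' : ι, π u = u → π u' = u' → u ≠ u' → ∑ j ∈ univ.filter (fun j => κ j = j), H u j * H u' j = 0) := by
  have hodd : Odd p := hp.odd_of_ne_two (by omega)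
  have hcard : (Fintype.card ι : ℤ) ≠ 0 := by rw [hι]; push_cast; omega
  have hT : IsHadamardMatrix Hᵀ := isHadamard_transpose hH hcard
  have hautT : IsSignedAut Hᵀ κ π e d := by
    obtain ⟨hd, he, h⟩ := haut
    refine ⟨he, hd, fun j i => ?_⟩
    rw [Matrix.transpose_apply, Matrix.transpose_apply, h i j]; ring
  have hcκ := card_fixed_add_classes κ hp hκ
  have hcπ := card_fixed_add_classes π hp hπ
  rw [hι] at hcκ hcπ
  have hwκ : 1 ≤ (blockClasses κ p).card := by
    by_contra h0
    have hf : (univ.filter fun j => κ j = j).card = 2 * p + 2 := by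
      have : (blockClasses κ p).card = 0 := by omega
      rw [this, zero_mul, add_zero] at hcκ; exact hcκ
    have hall : (univ.filter fun j => κ j = j) = univ := Finset.eq_univ_of_card _ (by rw [hf, hι])
    have hκ1 : κ = 1 := by
      ext j
      have := (Finset.mem_filter.mp (hall ▸ Finset.mem_univ j)).2
      simpa using this
    have hπ1 : π = 1 := by
      rw [hκ1] at hautT
      exact signedAut_snd_eq_one Hᵀ hT hcard hautT hodd hπ
    rcases hne with h | h
    · exact h hπ1
    · exact h hκ1
  have hwπ : 1 ≤ (blockClasses π p).card := by
    by_contra h0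
    have hf : (univ.filter fun i => π i = i).card = 2 * p + 2 := by
      have : (blockClasses π p).card = 0 := by omega
      rw [this, zero_mul, add_zero] at hcπ; exact hcπ
    have hall : (univ.filter fun i => π i = i) = univ := Finset.eq_univ_of_card _ (by rw [hf, hι])
    have hπ1 : π = 1 := by
      ext i
      have := (Finset.mem_filter.mp (hall ▸ Finset.mem_univ i)).2
      simpa using this
    have hκ1 : κ = 1 := by
      rw [hπ1] at haut
      exact signedAut_snd_eq_one H hH hcard haut hodd hκ
    rcases hne with h | h
    · exact h hπ1
    · exact h hκ1
  have hbr := fixedRows_le_two hH haut hp hp5 hι hκ hwκ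
  have hbc := fixedRows_le_two hT hautT hp hp5 hι hπ hwπ
  -- f + w p = 2p + 2 with f ≤ 2 ⇒ w = 2, f = 2 on both sides
  have hwκ2 : (blockClasses κ p).card = 2 := by
    have hle : (blockClasses κ p).card ≤ 2 := by
      by_contra h3
      have : 3 * p ≤ (blockClasses κ p).card * p := Nat.mul_le_mul_right p (by omega)
      omega
    by_contra hne2
    have hle1 : (blockClasses κ p).card ≤ 1 := by omega
    have : (blockClasses κ p).card * p ≤ 1 * p := Nat.mul_le_mul_right p hle1
    omega
  have hwπ2 : (blockClasses π p).card = 2 := by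
    have hle : (blockClasses π p).card ≤ 2 := by
      by_contra h3
      have : 3 * p ≤ (blockClasses π p).card * p := Nat.mul_le_mul_right p (by omega)
      omega
    by_contra hne2
    have hle1 : (blockClasses π p).card ≤ 1 := by omega
    have : (blockClasses π p).card * p ≤ 1 * p := Nat.mul_le_mul_right p hle1
    omega
  rw [hwκ2] at hcκ
  rw [hwπ2] at hcπ
  have hfκ : (univ.filter fun j => κ j = j).card = 2 := by omega
  have hfπ : (univ.filter fun i => π i = i).card = 2 := by omega
  refine ⟨hfπ, hfκ, hwπ2, hwκ2, ?_⟩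
  intro u u' hu hu' huu'
  have hlt : (univ.filter fun j => κ j = j).card < p := by rw [hfκ]; omega
  exact (hadamard_fixedRows_orth_of_card_lt hH π κ d e haut hp hodd hκ hlt hu hu' huu').1

end order2p2

end Summit.Ventures.DiscreteObjects.Hadamard
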